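import Summits.ValiantsHypothesis.ValiantsHypothesis.Theorems.SymPencilPerFourToricEqualRows
import Summits.ValiantsHypothesis.ValiantsHypothesis.Theorems.SymPencilPerFourPermOrthThree

/-!
# Route `SymPencil` — the toric case at dimension `6`, VIII: four pairwise distinct row images
# (`--supports` stmt-ValiantsHypothesis-5674; crux workfile `Cruxes/SdcSuperquadratic/TORIC-SIX.md`,
# CASE 2)

`W` `6`-dimensional with H3, all row ranks `2`, column ranks `≤ 2`, and the four row images
`L_0, …, L_3` pairwise distinct.  **Theorem** (`false_of_rows_distinct`): impossible.  For every
row pair the pair lever has a `≥ 3`-dimensional kernel `L_q + L_{q'}`, so every pair space `X_R`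
is `2`-dimensional with all `2 × 2` subpermanents vanishing.  A graph-type `X_R` forces
`L_p = L_{p'}` (`rows_eq_pair_of_graph`); a `2`-dimensional single-row space forces a graph-type
pair among the other rows; and a single-row line `K u_p` inside `X_R` forces one in row `p'` too
(perm-orthogonality).  Hence all four rows carry single-row lines `K u_p`, pairwise
perm-orthogonal, so supported on one common column (`common_support_of_perm_orth_three`,
val-width-5674-p3 g0), which then has rank `≥ 3`.  Honest framing: the last case of the toric
case of `R6`; nothing here changes `sdc(per_4) ≥ 25`; the crux `SdcSuperquadratic` and `VP ≠ VNP`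
are untouched.  No definitions, no named facts. [folklore]
-/

noncomputable section

-- single-conjunct layout: Sub = Summit, duplicated namespace component intended
set_option linter.dupNamespace false

namespace Summit.ValiantsHypothesis.ValiantsHypothesis.Theorems.SymPencilPerFourToricDistinct

open Matrix Finset Module
open Literature.Computability.AlgebraicComplexity
open Literature.Computability.AlgebraicComplexity.AlperBogartVelasco
open Summit.ValiantsHypothesis.ValiantsHypothesis.Theorems.SymPencilPerFourHessianRankThreeZero
open Summit.ValiantsHypothesis.ValiantsHypothesis.Theorems.SymPencilPerFourHessianToric
open Summit.ValiantsHypothesis.ValiantsHypothesis.Theorems.SymPencilPerFourToricLever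
open Summit.ValiantsHypothesis.ValiantsHypothesis.Theorems.SymPencilPerFourToricZeroRow
open Summit.ValiantsHypothesis.ValiantsHypothesis.Theorems.SymPencilPerFourToricLowRank
open Summit.ValiantsHypothesis.ValiantsHypothesis.Theorems.SymPencilPerFourToricTwoRow
open Summit.ValiantsHypothesis.ValiantsHypothesis.Theorems.SymPencilPerFourToricEqualRows
open Summit.ValiantsHypothesis.ValiantsHypothesis.Theorems.SymPencilPerFourToricSingleRow
open Summit.ValiantsHypothesis.ValiantsHypothesis.Theorems.SymPencilPerFourPermOrthThree

variable {K : Type*} [Field K]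

/-- **A graph-type pair space forces equal row images.**  If `X ≤ W` is a `2`-dimensional space
supported on rows `q, q'` with vanishing subpermanents and no element with row `q` or row `q'`
zero, and both rows of `W` have rank `2`, then `L_q = L_{q'}`. [folklore] -/
theorem rows_eq_of_graph_pair [CharZero K] (W X : Submodule K (Fin 4 × Fin 4 → K)) (hXW : X ≤ W)
    (q q' : Fin 4)
    (hP : ∀ x ∈ X, ∀ l l' : Fin 4, l ≠ l' → x (q, l) * x (q', l') + x (q, l') * x (q', l) = 0)
    (hZ : ∀ x ∈ X, (∀ j, x (q, j) = 0) → x = 0) (hZ' : ∀ x ∈ X, (∀ j, x (q', j) = 0) → x = 0)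
    (h2 : finrank K X = 2)
    (hnq : finrank K (W.map (LinearMap.funLeft K K fun j : Fin 4 => (q, j))) = 2)
    (hnq' : finrank K (W.map (LinearMap.funLeft K K fun j : Fin 4 => (q', j))) = 2) :
    W.map (LinearMap.funLeft K K fun j : Fin 4 => (q, j)) =
      W.map (LinearMap.funLeft K K fun j : Fin 4 => (q', j)) := by
  classical
  obtain ⟨k, l, hkl, -, hontoq, hontoq'⟩ := rows_eq_pair_of_graph X q q' hP hZ hZ' h2
  set S : Submodule K (Fin 4 → K) :=
    Submodule.span K (Set.range ![(Pi.single k (1 : K) : Fin 4 → K), Pi.single l 1]) with hS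
  have hli : LinearIndependent K ![(Pi.single k (1 : K) : Fin 4 → K), Pi.single l 1] := by
    have h' : LinearIndependent K (⇑(Pi.basisFun K (Fin 4)) ∘ ![k, l]) :=
      (Pi.basisFun K (Fin 4)).linearIndependent.comp _
        (by intro a b hab; fin_cases a <;> fin_cases b <;> simp_all)
    convert h' using 1
    ext i : 1
    fin_cases i <;> simp
  have hS2 : finrank K S = 2 := by rw [hS, finrank_span_eq_card hli, Fintype.card_fin]
  have key : ∀ (r : Fin 4), finrank K (W.map (LinearMap.funLeft K K fun j : Fin 4 => (r, j))) = 2 →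
      (∀ v : Fin 4 → K, (∀ m, m ≠ k → m ≠ l → v m = 0) → ∃ x ∈ X, ∀ j, x (r, j) = v j) →
      W.map (LinearMap.funLeft K K fun j : Fin 4 => (r, j)) = S := by
    intro r hnr honto
    symm
    apply Submodule.eq_of_le_of_finrank_le
    · rw [hS, Submodule.span_le]
      rintro _ ⟨i, rfl⟩
      fin_cases i
      · obtain ⟨x, hx, hxr⟩ := honto (Pi.single k 1) (fun m hmk _ => Pi.single_eq_of_ne hmk _)
        exact ⟨x, hXW hx, funext fun j => by simpa using hxr j⟩
      · obtain ⟨x, hx, hxr⟩ := honto (Pi.single l 1) (fun m _ hml => Pi.single_eq_of_ne hml _)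
        exact ⟨x, hXW hx, funext fun j => by simpa using hxr j⟩
    · rw [hnr, hS2]
  rw [key q hnq hontoq, key q' hnq' hontoq']

set_option maxHeartbeats 1600000 in
/-- **CASE 2 of the toric case: four pairwise distinct row images are impossible.**  See the
module docstring. [folklore] -/
theorem false_of_rows_distinct [CharZero K] (W : Submodule K (Fin 4 × Fin 4 → K))
    (hW3 : ∀ x ∈ W, ∀ (r c : Fin 3 → Fin 4), Function.Injective r → Function.Injective c →
      ((Matrix.of fun i j => x (i, j)).submatrix r c).permanent = 0)
    (hcol : ∀ l : Fin 4, finrank K (W.map (LinearMap.funLeft K K fun i : Fin 4 => (i, l))) ≤ 2)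
    (h6 : finrank K W = 6)
    (hn2 : ∀ r : Fin 4, finrank K (W.map (LinearMap.funLeft K K fun j : Fin 4 => (r, j))) = 2)
    (hdist : ∀ r r' : Fin 4, r ≠ r' → W.map (LinearMap.funLeft K K fun j : Fin 4 => (r, j)) ≠
      W.map (LinearMap.funLeft K K fun j : Fin 4 => (r', j))) : False := by
  classical
  have hrow : ∀ r : Fin 4, finrank K (W.map (LinearMap.funLeft K K fun j : Fin 4 => (r, j))) ≤ 2 :=
    fun r => (hn2 r).le
  have eρ : ∀ (r : Fin 4) (x : Fin 4 × Fin 4 → K) (j : Fin 4),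
      (LinearMap.funLeft K K fun j : Fin 4 => (r, j)) x j = x (r, j) := fun _ _ _ => rfl
  -- Step 1: all pair spaces have vanishing subpermanents
  have hP : ∀ p p' q q' : Fin 4, p ≠ p' → p ≠ q → p ≠ q' → p' ≠ q → p' ≠ q' → q ≠ q' →
      ∀ x ∈ W, (∀ j, x (q, j) = 0) → (∀ j, x (q', j) = 0) →
      ∀ l l' : Fin 4, l ≠ l' → x (p, l) * x (p', l') + x (p, l') * x (p', l) = 0 := by
    intro p p' q q' hpp' hpq hpq' hp'q hp'q' hqq' x hx hxq hxq'
    set Lq := W.map (LinearMap.funLeft K K fun j : Fin 4 => (q, j)) with hLq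
    set Lq' := W.map (LinearMap.funLeft K K fun j : Fin 4 => (q', j)) with hLq'
    set M : Submodule K (Fin 4 → K) := Lq ⊔ Lq' with hM
    have hM3 : 3 ≤ finrank K M := by
      have h := Submodule.finrank_sup_add_finrank_inf_eq Lq Lq'
      have e1 : finrank K Lq = 2 := hn2 q
      have e2 : finrank K Lq' = 2 := hn2 q'
      have hinf : finrank K ↥(Lq ⊓ Lq') ≤ 1 := by
        by_contra hge
        push Not at hge
        have a1 : Lq ⊓ Lq' = Lq := Submodule.eq_of_le_of_finrank_le inf_le_left (by omega)
        have a2 : Lq ⊓ Lq' = Lq' := Submodule.eq_of_le_of_finrank_le inf_le_right (by omega)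
        exact hdist q q' hqq' (a1.symm.trans a2)
      rw [hM]; omega
    refine perms_vanish_of_lever_three M hM3 x p p' fun u hu j₀ j₁ j₂ h01 h02 h12 => ?_
    rw [hM, Submodule.mem_sup] at hu
    obtain ⟨u₁, hu₁, u₂, hu₂, rfl⟩ := hu
    obtain ⟨y₁, hy₁, rfl⟩ := hu₁
    obtain ⟨y₂, hy₂, rfl⟩ := hu₂
    have e1 := pair_lever W hW3 hx hy₁ hpp' hpq hp'q hxq h01 h02 h12
    have e2 := pair_lever W hW3 hx hy₂ hpp' hpq' hp'q' hxq' h01 h02 h12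
    simp only [Pi.add_apply, eρ]
    linear_combination e1 + e2
  -- pair spaces have dimension 2
  have hX2 : ∀ p p' q q' : Fin 4, p ≠ p' → p ≠ q → p ≠ q' → p' ≠ q → p' ≠ q' → q ≠ q' →
      finrank K ↥(W ⊓ LinearMap.ker (LinearMap.funLeft K K fun j : Fin 4 => (q, j)) ⊓
        LinearMap.ker (LinearMap.funLeft K K fun j : Fin 4 => (q', j))) = 2 := by
    intro p p' q q' hpp' hpq hpq' hp'q hp'q' hqq'
    set X := W ⊓ LinearMap.ker (LinearMap.funLeft K K fun j : Fin 4 => (q, j)) ⊓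
        LinearMap.ker (LinearMap.funLeft K K fun j : Fin 4 => (q', j)) with hX
    have d : finrank K W ≤ finrank K X + _ + _ := finrank_pair_le W q q'
    have hq2 := hn2 q; have hq'2 := hn2 q'
    have memX : ∀ x, x ∈ X ↔ x ∈ W ∧ (∀ j, x (q, j) = 0) ∧ ∀ j, x (q', j) = 0 := fun x => by
      rw [hX]; exact mem_pair_iff W q q' x
    obtain ⟨-, -, -, -, -, hall⟩ := exists_other_two q q' hqq'
    have hXrows : ∀ x ∈ X, ∀ i j : Fin 4, i ≠ p → i ≠ p' → x (i, j) = 0 := by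
      intro x hx i j hip hip'
      obtain ⟨-, hxq, hxq'⟩ := (memX x).1 hx
      rcases eq_or_of_four p p' q q' hpp' hpq hpq' hp'q hp'q' hqq' i with hi | hi | hi | hi
      exacts [absurd hi hip, absurd hi hip', by rw [hi]; exact hxq j, by rw [hi]; exact hxq' j]
    have hle := finrank_le_two_of_perms_vanish X p p' hXrows
      (fun x hx => by obtain ⟨hxW, hxq, hxq'⟩ := (memX x).1 hx
                      exact hP p p' q q' hpp' hpq hpq' hp'q hp'q' hqq' x hxW hxq hxq')
      ((Submodule.finrank_mono (Submodule.map_mono (inf_le_left.trans inf_le_left))).trans (hrow p))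
      ((Submodule.finrank_mono (Submodule.map_mono (inf_le_left.trans inf_le_left))).trans (hrow p'))
    omega
  -- graph-type pairs are excluded: some non-zero element of `X_{pp'}` has row `p` or row `p'` zero
  have hgraph : ∀ p p' q q' : Fin 4, p ≠ p' → p ≠ q → p ≠ q' → p' ≠ q → p' ≠ q' → q ≠ q' →
      (∀ x ∈ W, (∀ j, x (q, j) = 0) → (∀ j, x (q', j) = 0) → (∀ j, x (p, j) = 0) → x = 0) →
      (∀ x ∈ W, (∀ j, x (q, j) = 0) → (∀ j, x (q', j) = 0) → (∀ j, x (p', j) = 0) → x = 0) →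
      False := by
    intro p p' q q' hpp' hpq hpq' hp'q hp'q' hqq' hZ hZ'
    set X := W ⊓ LinearMap.ker (LinearMap.funLeft K K fun j : Fin 4 => (q, j)) ⊓
        LinearMap.ker (LinearMap.funLeft K K fun j : Fin 4 => (q', j)) with hX
    have memX : ∀ x, x ∈ X ↔ x ∈ W ∧ (∀ j, x (q, j) = 0) ∧ ∀ j, x (q', j) = 0 := fun x => by
      rw [hX]; exact mem_pair_iff W q q' x
    refine hdist p p' hpp' (rows_eq_of_graph_pair W X (inf_le_left.trans inf_le_left) p p'
      (fun x hx => by obtain ⟨hxW, hxq, hxq'⟩ := (memX x).1 hx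
                      exact hP p p' q q' hpp' hpq hpq' hp'q hp'q' hqq' x hxW hxq hxq')
      (fun x hx h => by obtain ⟨hxW, hxq, hxq'⟩ := (memX x).1 hx; exact hZ x hxW hxq hxq' h)
      (fun x hx h => by obtain ⟨hxW, hxq, hxq'⟩ := (memX x).1 hx; exact hZ' x hxW hxq hxq' h)
      (hX2 p p' q q' hpp' hpq hpq' hp'q hp'q' hqq') (hn2 p) (hn2 p'))
  -- Step 2A: no two independent single-row elements in one row
  have h2A : ∀ p p' q q' : Fin 4, p ≠ p' → p ≠ q → p ≠ q' → p' ≠ q → p' ≠ q' → q ≠ q' →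
      finrank K ↥(W ⊓ LinearMap.ker (LinearMap.funLeft K K fun j : Fin 4 => (q, j)) ⊓
        LinearMap.ker (LinearMap.funLeft K K fun j : Fin 4 => (q', j)) ⊓
        LinearMap.ker (LinearMap.funLeft K K fun j : Fin 4 => (p', j))) ≤ 1 := by
    intro p p' q q' hpp' hpq hpq' hp'q hp'q' hqq'
    by_contra hge
    push Not at hge
    set T := W ⊓ LinearMap.ker (LinearMap.funLeft K K fun j : Fin 4 => (q, j)) ⊓
        LinearMap.ker (LinearMap.funLeft K K fun j : Fin 4 => (q', j)) ⊓
        LinearMap.ker (LinearMap.funLeft K K fun j : Fin 4 => (p', j)) with hT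
    have memT : ∀ z, z ∈ T → z ∈ W ∧ (∀ j, z (q, j) = 0) ∧ (∀ j, z (q', j) = 0) ∧
        ∀ j, z (p', j) = 0 := by
      intro z hz
      rw [hT, Submodule.mem_inf, mem_pair_iff, LinearMap.mem_ker] at hz
      exact ⟨hz.1.1, hz.1.2.1, hz.1.2.2, fun j => congr_fun hz.2 j⟩
    -- the single-row spaces of `q` and `q'` vanish (they sit with `T` inside a 2-dim pair space)
    have hvan : ∀ s s' : Fin 4, s ≠ p → s' ≠ p → s ≠ s' → s ≠ p' → (s' = q ∨ s' = q') →
        (s = q ∨ s = q') →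
        ∀ z ∈ W, (∀ j, z (s, j) = 0) → (∀ j, z (p', j) = 0) → (∀ j, z (p, j) = 0) → z = 0 := by
      -- `z` is single-row `s'`; `T ⊕ K z` lies in the pair space of rows `p, s'` (zero on `s, p'`)
      intro s s' hsp hs'p hss' hsp' hs' hs z hzW hzs hzp' hzp
      by_contra hz0
      set Y := W ⊓ LinearMap.ker (LinearMap.funLeft K K fun j : Fin 4 => (s, j)) ⊓
        LinearMap.ker (LinearMap.funLeft K K fun j : Fin 4 => (p', j)) with hY
      have hs's : s' ≠ s := hss'.symm
      have hs'p' : s' ≠ p' := by rcases hs' with h | h <;> rw [h]; exacts [hp'q.symm, hp'q'.symm]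
      have hY2 : finrank K Y = 2 := hX2 p s' s p' hs'p.symm hsp.symm hpp' hs's hs'p' hsp'
      have hTY : T ≤ Y := by
        intro x hx
        obtain ⟨hxW, hxq, hxq', hxp'⟩ := memT x hx
        rw [hY, mem_pair_iff]
        refine ⟨hxW, fun j => ?_, hxp'⟩
        rcases hs with h | h <;> rw [h]; exacts [hxq j, hxq' j]
      have hzY : z ∈ Y := by rw [hY, mem_pair_iff]; exact ⟨hzW, hzs, hzp'⟩
      have hzT : z ∉ T := by
        intro hzT
        obtain ⟨-, hzq, hzq', -⟩ := memT z hzT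
        apply hz0; funext e; obtain ⟨i, j⟩ := e
        rcases eq_or_of_four p p' q q' hpp' hpq hpq' hp'q hp'q' hqq' i with hi | hi | hi | hi <;>
          rw [hi]
        exacts [hzp j, hzp' j, hzq j, hzq' j]
      have hinf : T ⊓ (K ∙ z) = ⊥ := by
        rw [Submodule.eq_bot_iff]
        intro v hv
        obtain ⟨hv1, hv2⟩ := Submodule.mem_inf.1 hv
        rw [Submodule.mem_span_singleton] at hv2
        obtain ⟨c, rfl⟩ := hv2
        by_cases hc : c = 0
        · rw [hc, zero_smul]
        · exfalso; apply hzT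
          have := Submodule.smul_mem T c⁻¹ hv1
          rwa [smul_smul, inv_mul_cancel₀ hc, one_smul] at this
      have h := Submodule.finrank_sup_add_finrank_inf_eq T (K ∙ z)
      rw [hinf, finrank_bot, add_zero, finrank_span_singleton hz0] at h
      have hle : T ⊔ (K ∙ z) ≤ Y := sup_le hTY ((Submodule.span_singleton_le_iff_mem _ _).2 hzY)
      have := Submodule.finrank_mono hle
      omega
    -- hence the pair space of `q, q'` is of graph type
    refine hgraph q q' p p' hqq' hpq.symm hp'q.symm hpq'.symm hp'q'.symm hpp' ?_ ?_
    · intro x hxW hxp hxp' hxq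
      exact hvan q q' hpq.symm hpq'.symm hqq' hp'q.symm (Or.inr rfl) (Or.inl rfl) x hxW hxq hxp' hxp
    · intro x hxW hxp hxp' hxq'
      exact hvan q' q hpq'.symm hpq.symm hqq'.symm hp'q'.symm (Or.inl rfl) (Or.inr rfl) x hxW hxq'
        hxp' hxp
  -- Step 2B: a single-row line in row `p` forces one in row `p'`
  have h2B : ∀ p p' q q' : Fin 4, p ≠ p' → p ≠ q → p ≠ q' → p' ≠ q → p' ≠ q' → q ≠ q' →
      (∃ z ∈ W, z ≠ 0 ∧ ∀ i j, i ≠ p → z (i, j) = 0) →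
      ∃ z' ∈ W, z' ≠ 0 ∧ ∀ i j, i ≠ p' → z' (i, j) = 0 := by
    rintro p p' q q' hpp' hpq hpq' hp'q hp'q' hqq' ⟨z, hzW, hz0, hzs⟩
    set X := W ⊓ LinearMap.ker (LinearMap.funLeft K K fun j : Fin 4 => (q, j)) ⊓
        LinearMap.ker (LinearMap.funLeft K K fun j : Fin 4 => (q', j)) with hX
    have memX : ∀ x, x ∈ X ↔ x ∈ W ∧ (∀ j, x (q, j) = 0) ∧ ∀ j, x (q', j) = 0 := fun x => by
      rw [hX]; exact mem_pair_iff W q q' x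
    set T := X ⊓ LinearMap.ker (LinearMap.funLeft K K fun j : Fin 4 => (p', j)) with hT
    have hT1 : finrank K T ≤ 1 := h2A p p' q q' hpp' hpq hpq' hp'q hp'q' hqq'
    have hXd : finrank K X = 2 := hX2 p p' q q' hpp' hpq hpq' hp'q hp'q' hqq'
    have hzX : z ∈ X := (memX z).2 ⟨hzW, fun j => hzs q j hpq.symm, fun j => hzs q' j hpq'.symm⟩
    -- an element of `X` with row `p'` non-zero
    obtain ⟨x, hxX, hxT⟩ : ∃ x ∈ X, x ∉ T := by
      by_contra h; push Not at h
      have : X ≤ T := h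
      have := Submodule.finrank_mono this
      omega
    obtain ⟨hxW, hxq, hxq'⟩ := (memX x).1 hxX
    have hw : (fun j => x (p', j)) ≠ 0 := by
      intro h
      apply hxT
      rw [hT, Submodule.mem_inf, LinearMap.mem_ker]
      exact ⟨hxX, funext fun j => congr_fun h j⟩
    have hu : (fun j => z (p, j)) ≠ 0 := by
      intro h; apply hz0; funext e; obtain ⟨i, j⟩ := e
      by_cases hip : i = p
      · rw [hip]; exact congr_fun h j
      · exact hzs i j hip
    have hPX := fun y (hy : y ∈ X) => by
      obtain ⟨hyW, hyq, hyq'⟩ := (memX y).1 hy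
      exact hP p p' q q' hpp' hpq hpq' hp'q hp'q' hqq' y hyW hyq hyq'
    -- `u ⊥ w` and `x_p ⊥ w`
    have huw : ∀ l l' : Fin 4, l ≠ l' → z (p, l) * x (p', l') + z (p, l') * x (p', l) = 0 := by
      intro l l' hll'
      have h1 := hPX (x + z) (X.add_mem hxX hzX) l l' hll'
      have h0 := hPX x hxX l l' hll'
      simp only [Pi.add_apply, hzs p' _ hpp'.symm, add_zero] at h1
      linear_combination h1 - h0
    obtain ⟨k, l, hkl, huk, hwk, -, -⟩ := support_pair_of_perm_orth _ _ hu hw huw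
    have hxw := hPX x hxX
    -- `x - c z` is a non-zero single-row-`p'` element
    set c : K := x (p, k) / z (p, k) with hc
    refine ⟨x - c • z, W.sub_mem hxW (W.smul_mem c hzW), ?_, ?_⟩
    · intro h
      have := congr_fun h (p', k)
      simp only [Pi.sub_apply, Pi.smul_apply, smul_eq_mul, hzs p' k hpp'.symm, mul_zero,
        sub_zero, Pi.zero_apply] at this
      exact hwk this
    · intro i j hip'
      simp only [Pi.sub_apply, Pi.smul_apply, smul_eq_mul]
      by_cases hip : i = p
      · rw [hip]
        by_cases hjk : j = k
        · rw [hjk, hc, div_mul_cancel₀ _ huk, sub_self]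
        · have e1 := huw k j (Ne.symm hjk)    -- u_k w_j + u_j w_k = 0
          have e2 := hxw k j (Ne.symm hjk)    -- x_{pk} w_j + x_{pj} w_k = 0
          have h3 : x (p', k) * (x (p, j) - c * z (p, j)) = 0 := by
            rw [hc]
            field_simp
            linear_combination z (p, k) * e2 - x (p, k) * e1
          exact (mul_eq_zero.1 h3).resolve_left hwk
      · rw [hzs i j hip, mul_zero, sub_zero]
        rcases eq_or_of_four p p' q q' hpp' hpq hpq' hp'q hp'q' hqq' i with hi | hi | hi | hi
        exacts [absurd hi hip, absurd hi hip', by rw [hi]; exact hxq j, by rw [hi]; exact hxq' j]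
  -- Step 3: every row carries a single-row line
  have hsome : ∃ p, ∃ z ∈ W, z ≠ 0 ∧ ∀ i j, i ≠ p → z (i, j) = 0 := by
    by_contra h
    push Not at h
    refine hgraph 0 1 2 3 (by decide) (by decide) (by decide) (by decide) (by decide) (by decide)
      ?_ ?_
    · intro x hx h2 h3 h0
      by_contra hx0
      obtain ⟨i, j, hi, hij⟩ := h 1 x hx hx0
      fin_cases i
      · exact hij (h0 j)
      · exact hi rfl
      · exact hij (h2 j)
      · exact hij (h3 j)
    · intro x hx h2 h3 h1
      by_contra hx0
      obtain ⟨i, j, hi, hij⟩ := h 0 x hx hx0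
      fin_cases i
      · exact hi rfl
      · exact hij (h1 j)
      · exact hij (h2 j)
      · exact hij (h3 j)
  have hall : ∀ p : Fin 4, ∃ z ∈ W, z ≠ 0 ∧ ∀ i j, i ≠ p → z (i, j) = 0 := by
    obtain ⟨p₀, hz⟩ := hsome
    intro p
    by_cases hp : p = p₀
    · rw [hp]; exact hz
    obtain ⟨q, q', hqq', hqp₀, hqp, hq'p₀, hq'p, -⟩ := exists_other_two p₀ p (Ne.symm hp)
    exact h2B p₀ p q q' (Ne.symm hp) hqp₀.symm hq'p₀.symm hqp.symm hq'p.symm hqq' hz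
  choose z hzW hz0 hzs using hall
  -- pairwise perm-orthogonality of the row values
  have horth : ∀ p p' : Fin 4, p ≠ p' → ∀ l l' : Fin 4, l ≠ l' →
      z p (p, l) * z p' (p', l') + z p (p, l') * z p' (p', l) = 0 := by
    intro p p' hpp' l l' hll'
    obtain ⟨q, q', hqq', hqp, hqp', hq'p, hq'p', -⟩ := exists_other_two p p' hpp'
    have e := hP p p' q q' hpp' hqp.symm hq'p.symm hqp'.symm hq'p'.symm hqq' (z p + z p')
      (W.add_mem (hzW p) (hzW p')) (fun j => by rw [Pi.add_apply, hzs p q j hqp, hzs p' q j hqp', add_zero])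
      (fun j => by rw [Pi.add_apply, hzs p q' j hq'p, hzs p' q' j hq'p', add_zero]) l l' hll'
    simp only [Pi.add_apply, hzs p p' _ hpp'.symm, hzs p' p _ hpp', add_zero, zero_add] at e
    exact e
  have hu : ∀ p, (fun j => z p (p, j)) ≠ 0 := by
    intro p h; apply hz0 p; funext e; obtain ⟨i, j⟩ := e
    by_cases hip : i = p
    · rw [hip]; exact congr_fun h j
    · exact hzs p i j hip
  obtain ⟨c, hc⟩ := common_support_of_perm_orth_three (fun j => z 0 (0, j)) (fun j => z 1 (1, j))
    (fun j => z 2 (2, j)) (hu 0) (hu 1) (hu 2) (horth 0 1 (by decide)) (horth 0 2 (by decide))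
    (horth 1 2 (by decide))
  -- column `c` contains `e_0, e_1, e_2`
  set γ := (LinearMap.funLeft K K fun i : Fin 4 => (i, c)) with hγ
  have eγ : ∀ (x : Fin 4 × Fin 4 → K) (i : Fin 4), γ x i = x (i, c) := fun _ _ => rfl
  have hzc : ∀ p : Fin 4, (∀ l, l ≠ c → z p (p, l) = 0) → z p (p, c) ≠ 0 := by
    intro p hl h
    apply hz0 p; funext e; obtain ⟨i, j⟩ := e
    by_cases hip : i = p
    · rw [hip]; by_cases hjc : j = c
      · rw [hjc]; exact h
      · exact hl j hjc
    · exact hzs p i j hip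
  have hunit : ∀ p : Fin 4, (∀ l, l ≠ c → z p (p, l) = 0) →
      (Pi.single p (1 : K) : Fin 4 → K) ∈ W.map γ := by
    intro p hl
    refine ⟨(z p (p, c))⁻¹ • z p, W.smul_mem _ (hzW p), funext fun i => ?_⟩
    rw [map_smul, Pi.smul_apply, eγ, smul_eq_mul]
    by_cases hip : i = p
    · rw [hip, inv_mul_cancel₀ (hzc p hl), Pi.single_eq_same]
    · rw [hzs p i c hip, mul_zero, Pi.single_eq_of_ne hip]
  have hl0 : ∀ l, l ≠ c → z 0 (0, l) = 0 := fun l hl => (hc l hl).1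
  have hl1 : ∀ l, l ≠ c → z 1 (1, l) = 0 := fun l hl => (hc l hl).2.1
  have hl2 : ∀ l, l ≠ c → z 2 (2, l) = 0 := fun l hl => (hc l hl).2.2
  have hli : LinearIndependent K (⇑(Pi.basisFun K (Fin 4)) ∘ ![(0 : Fin 4), 1, 2]) :=
    (Pi.basisFun K (Fin 4)).linearIndependent.comp _ (injective_vec_three (by decide) (by decide) (by decide))
  have hspan : Submodule.span K (Set.range (⇑(Pi.basisFun K (Fin 4)) ∘ ![(0 : Fin 4), 1, 2])) ≤
      W.map γ := by
    rw [Submodule.span_le]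
    rintro _ ⟨i, rfl⟩
    fin_cases i
    · simpa using hunit 0 hl0
    · simpa using hunit 1 hl1
    · simpa using hunit 2 hl2
  have h3 := Submodule.finrank_mono hspan
  rw [finrank_span_eq_card hli, Fintype.card_fin] at h3
  have hcc : finrank K (W.map γ) ≤ 2 := hcol c
  omega

end Summit.ValiantsHypothesis.ValiantsHypothesis.Theorems.SymPencilPerFourToricDistinct

end
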